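import Mathlib
import HarnessLib
import Summits.HubbardSuperconductivity.HubbardSuperconductivity.Theorems.KLProgrammeMatsubaraPairWeightLattice

/-!
# Route `KLProgramme` — crux K3 split, ENGINE child (`KLRegimeEngineV11` stmt-HubbardSuperconductivity-19823): the SHARP joint Lipschitz constant of the
# slice propagator `Φ(k₀,e) = f(k₀²+e²)·(−ik₀+e)⁻¹` on an annulus — `(1 + r₂/r₁)·L_f + M_f/r₁²` instead of `3L_g r₂² + M_g`
# (cell gate-hubbard-kl, seat hubbard-kl-k3c2-p2 «thermal-bar induction n ≤ nScales β + 1»)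

`klsp_lipschitz` (`…MatsubaraSlicePropagator`) bounds the joint Lipschitz constant of the slice propagator through the singularity-free weight `g = f/s`
(`3L_g r₂² + M_g`, `L_g = L_f/r₁² + M_f/r₁⁴`): at scale `n` (`r₁ = Λ_n/2`, `r₂ = 4Λ_n`, `L_f ≤ ℓ/Λ_n²`) this is `(192ℓ + 772M_f)/Λ_n²`.  Working with `f`
and the denominator `−ik₀ + e` directly on the annulus `r₁ ≤ |z| ≤ r₂` (`z = −ik₀ + e`, `|z|² = s`) gives
`‖Φ(p) − Φ(p')‖ ≤ ((1 + r₂/r₁)·L_f + M_f/r₁²)·(|k₀ − k₀'| + |e − e'|)` GLOBALLY (`klsq_propagator_lipschitz`): inside the annulus by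
`|s − s'| ≤ (|z| + |z'|)|z − z'|`, across its two boundary circles because `f` vanishes there (`‖f(s)‖ ≤ L_f·(s − r₁²)`, resp. `L_f·(r₂² − s)`), and
trivially when both points are off the annulus.  At scale `n`: `K = (9ℓ + 4M_f)/Λ_n²` (`klsq_propagator_lipschitz_scale`) — e.g. `112/Λ_n²` for the
carrier's weight (`ℓ = 34/3`, `M_f = 1`) against `3076/Λ_n²`.  Consequences restated with the sharp constant: the transfer shift
`klsq_slice_bubble_shift_norm_le` (`≤ (256/π)·M_f·(9ℓ' + 4M_f')·B_W·(|q₀| + δ_max)/Λ_n`) and the (2b) norm-inside mass `klsq_sum_norm_pair_shift_scale_le`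
(`≤ #S·(32/π)·M_f·(9ℓ' + 4M_f')·D/Λ_n²`).  Pure analysis.
-/

noncomputable section

namespace Summit.HubbardSuperconductivity.HubbardSuperconductivity.Theorems.KLRegimeSplit

set_option linter.dupNamespace false -- summit = problem name (single-conjunct summit), D-0017

open Real Finset Complex Literature.MathematicalPhysics.QuantumLattice Literature.Probability.LatticeModels
open Summit.HubbardSuperconductivity.HubbardSuperconductivity.Theorems.KLProgrammeLegKernels

/-! ## §1 The conjugate linear factor `−ik₀ + e` -/

/-- `‖−ik₀ + e‖ = √(k₀² + e²)`. -/
theorem klsq_norm_conj_lin (k₀ e : ℝ) : ‖(-I * k₀ + e : ℂ)‖ = Real.sqrt (k₀ ^ 2 + e ^ 2) := by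
  have h : ‖(-I * k₀ + e : ℂ)‖ ^ 2 = k₀ ^ 2 + e ^ 2 := by
    rw [Complex.sq_norm, Complex.normSq_apply]; simp; ring
  rw [← h, Real.sqrt_sq (norm_nonneg _)]

/-- `‖(−ik₀ + e) − (−ik₀' + e')‖ ≤ |k₀ − k₀'| + |e − e'|`. -/
theorem klsq_norm_conj_lin_sub_le (k₀ e k₀' e' : ℝ) :
    ‖(-I * k₀ + e : ℂ) - (-I * k₀' + e')‖ ≤ |k₀ - k₀'| + |e - e'| := by
  have h : (-I * k₀ + e : ℂ) - (-I * k₀' + e') = -I * ((k₀ - k₀' : ℝ) : ℂ) + ((e - e' : ℝ) : ℂ) := by push_cast; ring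
  rw [h]
  refine (norm_add_le _ _).trans ?_
  rw [norm_mul, norm_neg, Complex.norm_I, one_mul, Complex.norm_real, Complex.norm_real, Real.norm_eq_abs, Real.norm_eq_abs]

/-! ## §2 The sharp joint Lipschitz bound -/

section Sharp

variable {f : ℝ → ℂ} {Lf Mf r₁ r₂ : ℝ}

/-- One-sided estimate near the INNER circle: if `r₁² < s` (`s = k₀² + e²`) then `‖f(s)‖ ≤ L_f·(√s − r₁)·(√s + r₁)` (`f(r₁²) = 0`). -/
theorem klsq_norm_weight_le_inner (hlip : ∀ s s', ‖f s - f s'‖ ≤ Lf * |s - s'|) (hin : ∀ s, s ≤ r₁ ^ 2 → f s = 0)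
    {s : ℝ} (hs : r₁ ^ 2 < s) :
    ‖f s‖ ≤ Lf * ((Real.sqrt s - r₁) * (Real.sqrt s + r₁)) := by
  have h := hlip s (r₁ ^ 2)
  rw [hin _ le_rfl, sub_zero, abs_of_pos (by linarith)] at h
  have hs0 : 0 ≤ s := by nlinarith
  have hsq : (Real.sqrt s - r₁) * (Real.sqrt s + r₁) = s - r₁ ^ 2 := by
    nlinarith [Real.mul_self_sqrt hs0, Real.sqrt_nonneg s]
  rw [hsq]; exact h

/-- One-sided estimate near the OUTER circle: if `s < r₂²` then `‖f(s)‖ ≤ L_f·(r₂ − √s)·(r₂ + √s)` (`f(r₂²) = 0`). -/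
theorem klsq_norm_weight_le_outer (hlip : ∀ s s', ‖f s - f s'‖ ≤ Lf * |s - s'|) (hout : ∀ s, r₂ ^ 2 ≤ s → f s = 0)
    {s : ℝ} (hs0 : 0 ≤ s) (hs : s < r₂ ^ 2) :
    ‖f s‖ ≤ Lf * ((r₂ - Real.sqrt s) * (r₂ + Real.sqrt s)) := by
  have h := hlip s (r₂ ^ 2)
  rw [hout _ le_rfl, sub_zero, abs_of_neg (by linarith)] at h
  have hsq : (r₂ - Real.sqrt s) * (r₂ + Real.sqrt s) = -(s - r₂ ^ 2) := by
    nlinarith [Real.mul_self_sqrt hs0, Real.sqrt_nonneg s]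
  rw [hsq]; exact h

/-- The MIXED case: `p = (k₀, e)` in the open annulus `r₁² < s < r₂²`, `p'` off it (`s' ≤ r₁²` or `r₂² ≤ s'`):
`‖f(s)·(−ik₀+e)⁻¹‖ ≤ (1 + r₂/r₁)·L_f·(|k₀ − k₀'| + |e − e'|)`. -/
theorem klsq_propagator_mixed (hlip : ∀ s s', ‖f s - f s'‖ ≤ Lf * |s - s'|)
    (hin : ∀ s, s ≤ r₁ ^ 2 → f s = 0) (hout : ∀ s, r₂ ^ 2 ≤ s → f s = 0) (hr₁ : 0 < r₁) (hr₁₂ : r₁ ≤ r₂)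
    {k₀ e k₀' e' : ℝ} (hs1 : r₁ ^ 2 < k₀ ^ 2 + e ^ 2) (hs2 : k₀ ^ 2 + e ^ 2 < r₂ ^ 2)
    (hs' : k₀' ^ 2 + e' ^ 2 ≤ r₁ ^ 2 ∨ r₂ ^ 2 ≤ k₀' ^ 2 + e' ^ 2) :
    ‖f (k₀ ^ 2 + e ^ 2) * (-I * k₀ + e)⁻¹‖ ≤ (1 + r₂ / r₁) * Lf * (|k₀ - k₀'| + |e - e'|) := by
  have hLf : 0 ≤ Lf := by
    have := hlip 0 1; have h0 : (0:ℝ) ≤ ‖f 0 - f 1‖ := norm_nonneg _; norm_num at this; linarith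
  have hr₂ : 0 < r₂ := lt_of_lt_of_le hr₁ hr₁₂
  set s := k₀ ^ 2 + e ^ 2 with hs_def
  set s' := k₀' ^ 2 + e' ^ 2 with hs'_def
  set n := Real.sqrt s with hn_def
  set n' := Real.sqrt s' with hn'_def
  have hs0 : 0 ≤ s := by positivity
  have hs'0 : 0 ≤ s' := by positivity
  have hn1 : r₁ < n := by
    rw [hn_def, show r₁ = Real.sqrt (r₁ ^ 2) by rw [Real.sqrt_sq hr₁.le]]
    exact Real.sqrt_lt_sqrt (by positivity) hs1
  have hn2 : n < r₂ := by
    rw [hn_def, show r₂ = Real.sqrt (r₂ ^ 2) by rw [Real.sqrt_sq hr₂.le]]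
    exact Real.sqrt_lt_sqrt hs0 hs2
  have hnpos : 0 < n := hr₁.trans hn1
  have hnz : ‖(-I * k₀ + e : ℂ)‖ = n := klsq_norm_conj_lin k₀ e
  have hnz' : ‖(-I * k₀' + e' : ℂ)‖ = n' := klsq_norm_conj_lin k₀' e'
  -- `|n − n'| ≤ ‖z − z'‖ ≤ |Δk| + |Δe|`
  have hΔ : |n - n'| ≤ |k₀ - k₀'| + |e - e'| := by
    rw [← hnz, ← hnz']
    exact (abs_norm_sub_norm_le _ _).trans (klsq_norm_conj_lin_sub_le k₀ e k₀' e')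
  have hD : 0 ≤ |k₀ - k₀'| + |e - e'| := by positivity
  rw [norm_mul, norm_inv, hnz]
  have hratio : 1 + r₂ / r₁ = (r₁ + r₂) / r₁ := by field_simp
  rcases hs' with hs' | hs'
  · -- `p'` inside the inner disc: `n' ≤ r₁`, `‖f s‖ ≤ L_f (n − r₁)(n + r₁)`, `(n + r₁)/n ≤ 2 ≤ 1 + r₂/r₁`
    have hn'le : n' ≤ r₁ := by
      rw [hn'_def, show r₁ = Real.sqrt (r₁ ^ 2) by rw [Real.sqrt_sq hr₁.le]]
      exact Real.sqrt_le_sqrt hs'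
    have hfs := klsq_norm_weight_le_inner hlip hin hs1
    have hgap : n - r₁ ≤ |k₀ - k₀'| + |e - e'| := by
      have : n - n' ≤ |n - n'| := le_abs_self _
      linarith
    calc ‖f s‖ * n⁻¹ ≤ Lf * ((n - r₁) * (n + r₁)) * n⁻¹ := mul_le_mul_of_nonneg_right hfs (inv_nonneg.mpr hnpos.le)
      _ = Lf * (n - r₁) * ((n + r₁) / n) := by field_simp
      _ ≤ Lf * (|k₀ - k₀'| + |e - e'|) * 2 := by
          refine mul_le_mul (mul_le_mul_of_nonneg_left hgap hLf) ?_ (by positivity) (by positivity)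
          rw [div_le_iff₀ hnpos]; linarith
      _ ≤ (1 + r₂ / r₁) * Lf * (|k₀ - k₀'| + |e - e'|) := by
          have h12 : (2 : ℝ) ≤ 1 + r₂ / r₁ := by
            rw [hratio, le_div_iff₀ hr₁]; linarith
          have : 0 ≤ Lf * (|k₀ - k₀'| + |e - e'|) := by positivity
          nlinarith
  · -- `p'` outside the outer disc: `r₂ ≤ n'`, `‖f s‖ ≤ L_f (r₂ − n)(r₂ + n)`, `(r₂ + n)/n ≤ 1 + r₂/r₁`
    have hn'ge : r₂ ≤ n' := by
      rw [hn'_def, show r₂ = Real.sqrt (r₂ ^ 2) by rw [Real.sqrt_sq hr₂.le]]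
      exact Real.sqrt_le_sqrt hs'
    have hfs := klsq_norm_weight_le_outer hlip hout hs0 hs2
    have hgap : r₂ - n ≤ |k₀ - k₀'| + |e - e'| := by
      have : n' - n ≤ |n - n'| := by rw [abs_sub_comm]; exact le_abs_self _
      linarith
    calc ‖f s‖ * n⁻¹ ≤ Lf * ((r₂ - n) * (r₂ + n)) * n⁻¹ := mul_le_mul_of_nonneg_right hfs (inv_nonneg.mpr hnpos.le)
      _ = Lf * (r₂ - n) * ((r₂ + n) / n) := by field_simp
      _ ≤ Lf * (|k₀ - k₀'| + |e - e'|) * (1 + r₂ / r₁) := by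
          refine mul_le_mul (mul_le_mul_of_nonneg_left hgap hLf) ?_ (by positivity) (by positivity)
          rw [hratio, div_le_div_iff₀ hnpos hr₁]
          nlinarith
      _ = (1 + r₂ / r₁) * Lf * (|k₀ - k₀'| + |e - e'|) := by ring

/-- **The sharp joint Lipschitz bound of the slice propagator.**  For a shell weight `f` (`L_f`-Lipschitz in `s`, `‖f‖ ≤ M_f`, `f(s) = 0` for
`s ≤ r₁²` and for `s ≥ r₂²`, `0 < r₁ ≤ r₂`), the propagator `Φ(k₀,e) = f(k₀²+e²)·(−ik₀+e)⁻¹` satisfies, for ALL `(k₀,e), (k₀',e')`: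
`‖Φ(k₀,e) − Φ(k₀',e')‖ ≤ ((1 + r₂/r₁)·L_f + M_f/r₁²)·(|k₀ − k₀'| + |e − e'|)`. -/
theorem klsq_propagator_lipschitz (hlip : ∀ s s', ‖f s - f s'‖ ≤ Lf * |s - s'|) (hbd : ∀ s, ‖f s‖ ≤ Mf)
    (hin : ∀ s, s ≤ r₁ ^ 2 → f s = 0) (hout : ∀ s, r₂ ^ 2 ≤ s → f s = 0) (hr₁ : 0 < r₁) (hr₁₂ : r₁ ≤ r₂)
    (k₀ e k₀' e' : ℝ) :
    ‖f (k₀ ^ 2 + e ^ 2) * (-I * k₀ + e)⁻¹ - f (k₀' ^ 2 + e' ^ 2) * (-I * k₀' + e')⁻¹‖ ≤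
      ((1 + r₂ / r₁) * Lf + Mf / r₁ ^ 2) * (|k₀ - k₀'| + |e - e'|) := by
  have hLf : 0 ≤ Lf := by
    have := hlip 0 1; have h0 : (0:ℝ) ≤ ‖f 0 - f 1‖ := norm_nonneg _; norm_num at this; linarith
  have hMf : 0 ≤ Mf := (norm_nonneg _).trans (hbd 0)
  have hr₂ : 0 < r₂ := lt_of_lt_of_le hr₁ hr₁₂
  have hD : 0 ≤ |k₀ - k₀'| + |e - e'| := by positivity
  have hK1 : 0 ≤ (1 + r₂ / r₁) * Lf := by positivity
  have hK2 : 0 ≤ Mf / r₁ ^ 2 := by positivity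
  -- the off-annulus predicate
  have hoff : ∀ {a b : ℝ}, (a ^ 2 + b ^ 2 ≤ r₁ ^ 2 ∨ r₂ ^ 2 ≤ a ^ 2 + b ^ 2) → f (a ^ 2 + b ^ 2) * (-I * a + b)⁻¹ = 0 := by
    intro a b h
    rcases h with h | h
    · rw [hin _ h, zero_mul]
    · rw [hout _ h, zero_mul]
  by_cases hp : k₀ ^ 2 + e ^ 2 ≤ r₁ ^ 2 ∨ r₂ ^ 2 ≤ k₀ ^ 2 + e ^ 2
  · by_cases hp' : k₀' ^ 2 + e' ^ 2 ≤ r₁ ^ 2 ∨ r₂ ^ 2 ≤ k₀' ^ 2 + e' ^ 2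
    · rw [hoff hp, hoff hp', sub_zero, norm_zero]; positivity
    · -- `p` off, `p'` in the annulus
      push Not at hp'
      rw [hoff hp, zero_sub, norm_neg]
      have h := klsq_propagator_mixed hlip hin hout hr₁ hr₁₂ hp'.1 hp'.2 hp
      rw [abs_sub_comm k₀' k₀, abs_sub_comm e' e] at h
      refine h.trans ?_
      nlinarith
  · push Not at hp
    by_cases hp' : k₀' ^ 2 + e' ^ 2 ≤ r₁ ^ 2 ∨ r₂ ^ 2 ≤ k₀' ^ 2 + e' ^ 2
    · rw [hoff hp', sub_zero]
      refine (klsq_propagator_mixed hlip hin hout hr₁ hr₁₂ hp.1 hp.2 hp').trans ?_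
      nlinarith
    · -- both in the annulus
      push Not at hp'
      set s := k₀ ^ 2 + e ^ 2 with hs_def
      set s' := k₀' ^ 2 + e' ^ 2 with hs'_def
      set z : ℂ := -I * k₀ + e with hz_def
      set z' : ℂ := -I * k₀' + e' with hz'_def
      have hs0 : 0 ≤ s := by positivity
      have hs'0 : 0 ≤ s' := by positivity
      have hnz : ‖z‖ = Real.sqrt s := klsq_norm_conj_lin k₀ e
      have hnz' : ‖z'‖ = Real.sqrt s' := klsq_norm_conj_lin k₀' e'
      have hn1 : r₁ < ‖z‖ := by
        rw [hnz, show r₁ = Real.sqrt (r₁ ^ 2) by rw [Real.sqrt_sq hr₁.le]]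
        exact Real.sqrt_lt_sqrt (by positivity) hp.1
      have hn1' : r₁ < ‖z'‖ := by
        rw [hnz', show r₁ = Real.sqrt (r₁ ^ 2) by rw [Real.sqrt_sq hr₁.le]]
        exact Real.sqrt_lt_sqrt (by positivity) hp'.1
      have hn2' : ‖z'‖ < r₂ := by
        rw [hnz', show r₂ = Real.sqrt (r₂ ^ 2) by rw [Real.sqrt_sq hr₂.le]]
        exact Real.sqrt_lt_sqrt hs'0 hp'.2
      have hzpos : 0 < ‖z‖ := hr₁.trans hn1
      have hz'pos : 0 < ‖z'‖ := hr₁.trans hn1'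
      have hz0 : z ≠ 0 := norm_pos_iff.mp hzpos
      have hz'0 : z' ≠ 0 := norm_pos_iff.mp hz'pos
      have hΔ : ‖z - z'‖ ≤ |k₀ - k₀'| + |e - e'| := klsq_norm_conj_lin_sub_le k₀ e k₀' e'
      -- `|s − s'| = |‖z‖² − ‖z'‖²| ≤ (‖z‖ + ‖z'‖)‖z − z'‖`
      have hss : |s - s'| ≤ (‖z‖ + ‖z'‖) * ‖z - z'‖ := by
        have h1 : s = ‖z‖ ^ 2 := by rw [hnz, Real.sq_sqrt hs0]
        have h2 : s' = ‖z'‖ ^ 2 := by rw [hnz', Real.sq_sqrt hs'0]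
        rw [h1, h2, sq_sub_sq, abs_mul, abs_of_pos (by positivity)]
        exact mul_le_mul_of_nonneg_left (abs_norm_sub_norm_le z z') (by positivity)
      -- split `f s/z − f s'/z' = (f s − f s')/z + f s' (1/z − 1/z')`
      have hsplit : f s * z⁻¹ - f s' * z'⁻¹ = (f s - f s') * z⁻¹ + f s' * (z⁻¹ - z'⁻¹) := by ring
      rw [hsplit]
      have hA : ‖(f s - f s') * z⁻¹‖ ≤ (1 + r₂ / r₁) * Lf * (|k₀ - k₀'| + |e - e'|) := by
        rw [norm_mul, norm_inv]
        calc ‖f s - f s'‖ * ‖z‖⁻¹ ≤ Lf * ((‖z‖ + ‖z'‖) * ‖z - z'‖) * ‖z‖⁻¹ :=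
              mul_le_mul_of_nonneg_right ((hlip s s').trans (mul_le_mul_of_nonneg_left hss hLf)) (inv_nonneg.mpr hzpos.le)
          _ = Lf * ((‖z‖ + ‖z'‖) / ‖z‖) * ‖z - z'‖ := by field_simp
          _ ≤ Lf * (1 + r₂ / r₁) * (|k₀ - k₀'| + |e - e'|) := by
              refine mul_le_mul (mul_le_mul_of_nonneg_left ?_ hLf) hΔ (norm_nonneg _) (by positivity)
              rw [div_le_iff₀ hzpos]
              have : ‖z'‖ ≤ r₂ / r₁ * ‖z‖ := by
                rw [div_mul_eq_mul_div, le_div_iff₀ hr₁]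
                nlinarith
              linarith
          _ = (1 + r₂ / r₁) * Lf * (|k₀ - k₀'| + |e - e'|) := by ring
      have hB : ‖f s' * (z⁻¹ - z'⁻¹)‖ ≤ Mf / r₁ ^ 2 * (|k₀ - k₀'| + |e - e'|) := by
        rw [norm_mul]
        have hinv : z⁻¹ - z'⁻¹ = (z' - z) * (z⁻¹ * z'⁻¹) := by field_simp
        rw [hinv, norm_mul, norm_mul, norm_inv, norm_inv, norm_sub_rev]
        calc ‖f s'‖ * (‖z - z'‖ * (‖z‖⁻¹ * ‖z'‖⁻¹)) ≤ Mf * ((|k₀ - k₀'| + |e - e'|) * (r₁⁻¹ * r₁⁻¹)) := by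
              refine mul_le_mul (hbd s') (mul_le_mul hΔ ?_ (by positivity) hD) (by positivity) hMf
              exact mul_le_mul (inv_anti₀ hr₁ hn1.le) (inv_anti₀ hr₁ hn1'.le) (by positivity) (by positivity)
          _ = Mf / r₁ ^ 2 * (|k₀ - k₀'| + |e - e'|) := by field_simp
      calc ‖(f s - f s') * z⁻¹ + f s' * (z⁻¹ - z'⁻¹)‖ ≤ ‖(f s - f s') * z⁻¹‖ + ‖f s' * (z⁻¹ - z'⁻¹)‖ := norm_add_le _ _
        _ ≤ (1 + r₂ / r₁) * Lf * (|k₀ - k₀'| + |e - e'|) + Mf / r₁ ^ 2 * (|k₀ - k₀'| + |e - e'|) := add_le_add hA hB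
        _ = ((1 + r₂ / r₁) * Lf + Mf / r₁ ^ 2) * (|k₀ - k₀'| + |e - e'|) := by ring

/-- **Scale form**: at scale `n` (`r₁ = Λ_n/2`, `r₂ = 4Λ_n`, `L_f ≤ ℓ/Λ_n²`) the joint Lipschitz constant is `(9ℓ + 4M_f)/Λ_n²`, also in the
singularity-free form `(f(s)/s)(ik₀+e)` of `…MatsubaraSlicePropagator`. -/
theorem klsq_propagator_lipschitz_scale {ℓ : ℝ} (hlip : ∀ s s', ‖f s - f s'‖ ≤ Lf * |s - s'|) (hbd : ∀ s, ‖f s‖ ≤ Mf) {n : ℕ}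
    (hLf : Lf ≤ ℓ / klScale klE0 n ^ 2)
    (hin : ∀ s, s ≤ (klScale klE0 n / 2) ^ 2 → f s = 0) (hout : ∀ s, (4 * klScale klE0 n) ^ 2 ≤ s → f s = 0)
    (k₀ e k₀' e' : ℝ) :
    ‖f (k₀ ^ 2 + e ^ 2) / (((k₀ ^ 2 + e ^ 2 : ℝ)) : ℂ) * (I * k₀ + e) -
        f (k₀' ^ 2 + e' ^ 2) / (((k₀' ^ 2 + e' ^ 2 : ℝ)) : ℂ) * (I * k₀' + e')‖ ≤
      (9 * ℓ + 4 * Mf) / klScale klE0 n ^ 2 * (|k₀ - k₀'| + |e - e'|) := by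
  have hΛ := klth_klScale_pos n
  have hMf : 0 ≤ Mf := (norm_nonneg _).trans (hbd 0)
  rw [klsp_div_propagator_eq f k₀ e, klsp_div_propagator_eq f k₀' e']
  have h := klsq_propagator_lipschitz hlip hbd hin hout (by positivity : 0 < klScale klE0 n / 2) (by linarith) k₀ e k₀' e'
  refine h.trans (mul_le_mul_of_nonneg_right ?_ (by positivity))
  have hLf0 : 0 ≤ Lf := by
    have := hlip 0 1; have h0 : (0:ℝ) ≤ ‖f 0 - f 1‖ := norm_nonneg _; norm_num at this; linarith
  have h9 : (1 + 4 * klScale klE0 n / (klScale klE0 n / 2)) = 9 := by field_simp; ring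
  rw [h9]
  have : 9 * Lf ≤ 9 * ℓ / klScale klE0 n ^ 2 := by rw [mul_div_assoc]; exact mul_le_mul_of_nonneg_left hLf (by norm_num)
  have h4 : Mf / (klScale klE0 n / 2) ^ 2 = 4 * Mf / klScale klE0 n ^ 2 := by field_simp; ring
  rw [h4, add_div]
  linarith

end Sharp

/-! ## §3 Consequences with the sharp constant -/

section Consequences

variable {f f' : ℝ → ℂ} {Mf Lf' Mf' ℓ' : ℝ} {W : ℝ → ℂ} {δ : ℝ → ℝ} {BW δmax : ℝ}

/-- **The transfer shift with the sharp constant**: as `klsp_slice_bubble_shift_norm_le` with `(1024/π)M_f(48ℓ'+193M_f')` replaced by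
`(256/π)·M_f·(9ℓ' + 4M_f')`. -/
theorem klsq_slice_bubble_shift_norm_le (hbd : ∀ s, ‖f s‖ ≤ Mf) {n : ℕ}
    (hin : ∀ s, s ≤ (klScale klE0 n / 2) ^ 2 → f s = 0) (hout : ∀ s, (4 * klScale klE0 n) ^ 2 ≤ s → f s = 0)
    (hlip' : ∀ s s', ‖f' s - f' s'‖ ≤ Lf' * |s - s'|) (hbd' : ∀ s, ‖f' s‖ ≤ Mf') (hLf' : Lf' ≤ ℓ' / klScale klE0 n ^ 2)
    (hin' : ∀ s, s ≤ (klScale klE0 n / 2) ^ 2 → f' s = 0) (hout' : ∀ s, (4 * klScale klE0 n) ^ 2 ≤ s → f' s = 0)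
    (hBW : 0 ≤ BW) (hWbd : ∀ e, |e| < 4 * klScale klE0 n → ‖W e‖ ≤ BW) (hδ0 : 0 ≤ δmax) (hδ : ∀ e, |δ e| ≤ δmax)
    (q₀ : ℝ) {β : ℝ} (hβ : klBetaMin ≤ β) (hn : n ≤ nScales β + 1) (M : ℕ) :
    ‖β⁻¹ • ∑ i : MatsubaraIdx M, ∫ e,
        W e * (f (matsubaraFreq β M i ^ 2 + e ^ 2) / (((matsubaraFreq β M i ^ 2 + e ^ 2 : ℝ)) : ℂ) * (I * (matsubaraFreq β M i) + e)) *
          (f' ((matsubaraFreq β M i + q₀) ^ 2 + (e + δ e) ^ 2) / ((((matsubaraFreq β M i + q₀) ^ 2 + (e + δ e) ^ 2 : ℝ)) : ℂ) *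
              (I * ((matsubaraFreq β M i + q₀ : ℝ) : ℂ) + ((e + δ e : ℝ) : ℂ)) -
            f' (matsubaraFreq β M i ^ 2 + e ^ 2) / (((matsubaraFreq β M i ^ 2 + e ^ 2 : ℝ)) : ℂ) * (I * (matsubaraFreq β M i) + e))‖ ≤
      256 / Real.pi * Mf * (9 * ℓ' + 4 * Mf') * BW * (|q₀| + δmax) / klScale klE0 n := by
  set Λ := klScale klE0 n with hΛdef
  have hΛ : 0 < Λ := klth_klScale_pos n
  have hβ0 : 0 < β := pos_of_klBetaMin_le hβ
  have hMf : 0 ≤ Mf := (norm_nonneg _).trans (hbd 0)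
  have hMf' : 0 ≤ Mf' := (norm_nonneg _).trans (hbd' 0)
  have hr₁ : 0 < Λ / 2 := by positivity
  have hr : 0 < 4 * Λ := by positivity
  have hLf'0 : 0 ≤ Lf' := by
    have := hlip' 0 1; have h0 : (0:ℝ) ≤ ‖f' 0 - f' 1‖ := norm_nonneg _; norm_num at this; linarith
  have hℓ' : 0 ≤ ℓ' := by
    have : 0 ≤ ℓ' / Λ ^ 2 := hLf'0.trans hLf'
    rwa [le_div_iff₀ (by positivity), zero_mul] at this
  have hgsupp : ∀ s, (4 * Λ) ^ 2 ≤ s → (fun s : ℝ => f s / ((s : ℝ) : ℂ)) s = 0 := fun s hs => by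
    simp only [hout s hs, zero_div]
  set K : ℝ := (9 * ℓ' + 4 * Mf') / Λ ^ 2 with hK
  have hK0 : 0 ≤ K := by positivity
  set D : ℝ := |q₀| + δmax with hD
  have hD0 : 0 ≤ D := by positivity
  have main := klsp_discrete_perturb_norm_le
    (Φ := fun k₀ e => f (k₀ ^ 2 + e ^ 2) / (((k₀ ^ 2 + e ^ 2 : ℝ)) : ℂ) * (I * k₀ + e))
    (Ψ := fun k₀ e => f' (k₀ ^ 2 + e ^ 2) / (((k₀ ^ 2 + e ^ 2 : ℝ)) : ℂ) * (I * k₀ + e)) (W := W) (δ := δ)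
    (A := Mf / (Λ / 2)) (by positivity) hK0 hBW hr.le hδ0
    (fun k₀ e => klsp_div_propagator_norm_le hbd hin hr₁ k₀ e)
    (fun k₀ hk e => klsp_zero_of_le_abs_fst hgsupp hr.le hk e)
    (fun k₀ e he => klsp_zero_of_le_abs_snd hgsupp hr.le k₀ he)
    (fun k₀ e k₀' e' => klsq_propagator_lipschitz_scale hlip' hbd' hLf' hin' hout' k₀ e k₀' e')
    hWbd hδ q₀ hβ0 M
  refine main.trans ?_
  have hcount := klsp_count_factor_le hβ hn
  rw [← hΛdef] at hcount
  calc (4 * Λ / Real.pi + 3 / β) * (2 * (4 * Λ) * (BW * (Mf / (Λ / 2)) * (K * D)))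
      ≤ (16 / Real.pi * Λ) * (2 * (4 * Λ) * (BW * (Mf / (Λ / 2)) * (K * D))) := mul_le_mul_of_nonneg_right hcount (by positivity)
    _ = 256 / Real.pi * Mf * (9 * ℓ' + 4 * Mf') * BW * D / Λ := by rw [hK]; field_simp; ring

/-- **(2b) norm-inside mass with the sharp constant** (cf. `klzl_sum_norm_pair_shift_scale_le`): `≤ #S·(32/π)·M_f·(9ℓ' + 4M_f')·D/Λ_n²`. -/
theorem klsq_sum_norm_pair_shift_scale_le {P : Type*} [Fintype P] (hbd : ∀ s, ‖f s‖ ≤ Mf) {n : ℕ}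
    (hin : ∀ s, s ≤ (klScale klE0 n / 2) ^ 2 → f s = 0) (hout : ∀ s, (4 * klScale klE0 n) ^ 2 ≤ s → f s = 0)
    (hlip' : ∀ s s', ‖f' s - f' s'‖ ≤ Lf' * |s - s'|) (hbd' : ∀ s, ‖f' s‖ ≤ Mf') (hLf' : Lf' ≤ ℓ' / klScale klE0 n ^ 2)
    (hin' : ∀ s, s ≤ (klScale klE0 n / 2) ^ 2 → f' s = 0) (hout' : ∀ s, (4 * klScale klE0 n) ^ 2 ≤ s → f' s = 0)
    (e₁ e₂ e₂₀ : P → ℝ) (S : Finset P) (hS : ∀ p, |e₁ p| < 4 * klScale klE0 n → p ∈ S)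
    {D : ℝ} (hD0 : 0 ≤ D) (hD : ∀ p, |e₂ p - e₂₀ p| ≤ D)
    {M : ℕ} {β : ℝ} (hβ : klBetaMin ≤ β) (hn : n ≤ nScales β + 1) :
    ∑ p, ‖β⁻¹ • ∑ i : MatsubaraIdx M,
        (f (matsubaraFreq β M i ^ 2 + e₁ p ^ 2) / (((matsubaraFreq β M i ^ 2 + e₁ p ^ 2 : ℝ)) : ℂ) *
          (I * (matsubaraFreq β M i) + (e₁ p : ℝ))) *
        ((f' ((-matsubaraFreq β M i) ^ 2 + e₂ p ^ 2) / ((((-matsubaraFreq β M i) ^ 2 + e₂ p ^ 2 : ℝ)) : ℂ) *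
            (I * ((-matsubaraFreq β M i : ℝ) : ℂ) + (e₂ p : ℝ))) -
          (f' ((-matsubaraFreq β M i) ^ 2 + e₂₀ p ^ 2) / ((((-matsubaraFreq β M i) ^ 2 + e₂₀ p ^ 2 : ℝ)) : ℂ) *
            (I * ((-matsubaraFreq β M i : ℝ) : ℂ) + (e₂₀ p : ℝ))))‖ ≤
      (S.card : ℝ) * (32 / Real.pi * Mf * (9 * ℓ' + 4 * Mf') * D / klScale klE0 n ^ 2) := by
  set Λ := klScale klE0 n with hΛdef
  have hΛ : 0 < Λ := klth_klScale_pos n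
  have hβ0 : 0 < β := pos_of_klBetaMin_le hβ
  have hMf : 0 ≤ Mf := (norm_nonneg _).trans (hbd 0)
  have hMf' : 0 ≤ Mf' := (norm_nonneg _).trans (hbd' 0)
  have hr₁ : 0 < Λ / 2 := by positivity
  have hr : 0 < 4 * Λ := by positivity
  have hLf'0 : 0 ≤ Lf' := by
    have := hlip' 0 1; have h0 : (0:ℝ) ≤ ‖f' 0 - f' 1‖ := norm_nonneg _; norm_num at this; linarith
  have hℓ' : 0 ≤ ℓ' := by
    have : 0 ≤ ℓ' / Λ ^ 2 := hLf'0.trans hLf'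
    rwa [le_div_iff₀ (by positivity), zero_mul] at this
  have hgsupp : ∀ s, (4 * Λ) ^ 2 ≤ s → (fun s : ℝ => f s / ((s : ℝ) : ℂ)) s = 0 := fun s hs => by
    simp only [hout s hs, zero_div]
  set K : ℝ := (9 * ℓ' + 4 * Mf') / Λ ^ 2 with hK
  have hK0 : 0 ≤ K := by positivity
  have h := klzl_sum_norm_pair_shift_le (P := P)
    (Φ := fun k₀ e => f (k₀ ^ 2 + e ^ 2) / (((k₀ ^ 2 + e ^ 2 : ℝ)) : ℂ) * (I * k₀ + e))
    (A := Mf / (Λ / 2)) (by positivity) hr.le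
    (fun k₀ e => klsp_div_propagator_norm_le hbd hin hr₁ k₀ e)
    (fun k₀ hk e => klsp_zero_of_le_abs_fst hgsupp hr.le hk e)
    (fun k₀ e he => klsp_zero_of_le_abs_snd hgsupp hr.le k₀ he)
    e₁ S hS
    (Φ' := fun k₀ e => f' (k₀ ^ 2 + e ^ 2) / (((k₀ ^ 2 + e ^ 2 : ℝ)) : ℂ) * (I * k₀ + e)) hK0
    (fun k₀ e k₀' e' => klsq_propagator_lipschitz_scale hlip' hbd' hLf' hin' hout' k₀ e k₀' e')
    e₂ e₂₀ hD0 hD (M := M) hβ0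
  refine (le_of_eq ?_).trans (h.trans (mul_le_mul_of_nonneg_left ?_ (Nat.cast_nonneg _)))
  · refine Finset.sum_congr rfl fun p _ => ?_
    push_cast
    rfl
  have hcs := klzl_count_mul_sup_le hMf hβ hn
  rw [← hΛdef] at hcs
  calc (4 * Λ / Real.pi + 3 / β) * (Mf / (Λ / 2) * (K * D))
      = ((4 * Λ / Real.pi + 3 / β) * (Mf / (Λ / 2))) * (K * D) := by ring
    _ ≤ (32 / Real.pi * Mf) * (K * D) := mul_le_mul_of_nonneg_right hcs (by positivity)
    _ = 32 / Real.pi * Mf * (9 * ℓ' + 4 * Mf') * D / Λ ^ 2 := by rw [hK]; field_simp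

end Consequences

end Summit.HubbardSuperconductivity.HubbardSuperconductivity.Theorems.KLRegimeSplit

end
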